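import Literature.Probability.Percolation.IntRawGoodUp
import Literature.Probability.Percolation.TriLowestCrossingProb
import HarnessLib

/-!
# Probability of raw failure of the inner explorations (twin of the probabilistic parts of `ArmSeparationRawGood(Up)`)

Topic `Literature/Probability/Percolation`; family `crit-perc` / near-critical percolation on `𝕋`.
A brick of the INNER half of the near-critical arm-separation theorem for four arms in the ADJACENT
colour arrangement (P. Nolin, EJP 13 (2008), Thm. 11, `j = 4`, `σ = BBWW` [arXiv 0711.4948:
Thm. 10], §4.4 Lemma 15 (4.20), internal extremities): at every density `p` where the frame and the
two ring inputs hold for the scales used,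
`P_p(∃ u < T, IntSeqFailRaw m u k₀ K) ≤ T · (1 - c_F² c_E c_I)^K` and the same for the exploration
from above (`IntSeqFailRawUp`), by the generic decoupling lemma
`JDomain.real_exists_lowestSeq_not_mem_le` (conditioning on `lower c z`, `K` independent annuli):
`real_exists_intSeqFailRaw_le_at`, `real_exists_intSeqFailRawUp_le_at`.

Everything here is proved; no named facts are introduced.

## References

* P. Nolin, Near-critical percolation in two dimensions, *Electron. J. Probab.* 13 (2008), §4.4
  Lemma 15 (proof, (4.20)), internal extremities (arXiv 0711.4948: Lemma 14) [Nolin2008].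
* H. Kesten, Scaling relations for 2D-percolation, *Comm. Math. Phys.* 109 (1987), Lemma 2 (2.26) [Kesten1987].
-/

noncomputable section

open Set MeasureTheory

namespace Literature.Probability.Percolation

open LatticeModels HalfAnnulus

/-- **Probability that some term of the inner exploration (from below or from above) is raw-bad on
all scales**, generic in the domain: for a `JDomain` `Q` with the cut and duality properties,
`P_p(∃ u < T, ∃ (c, z) = term u, TrapNoRSWL (Q.lower c z) z k₀ K) ≤ T (1 - c_F² c_E c_I)^K`. [cite: Nolin2008, §4.4 Lemma 15 (proof, (4.20)) (arXiv 0711.4948: Lemma 14)] [cite: Kesten1987, Lemma 2 (2.26)] -/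
theorem JDomain.real_exists_lowestSeq_noRSWL_le_at (Q : JDomain) (hcut : Q.CutProp) (hdual : Q.DualProp) (p : unitInterval)
    {cF cE cI : ℝ} (hcF : 0 < cF) (hcF1 : cF ≤ 1) (hcE : 0 ≤ cE) (hcE1 : cE ≤ 1) (hcI : 0 ≤ cI) (hcI1 : cI ≤ 1) {S S' : ℕ}
    (hF : ∀ (z : Site 2) (k : ℕ), 1 ≤ k → k < S → cF ≤ (triSitePercolation p).real (triFrameAt z k))
    (hEr : ∀ (z : Site 2) (k : ℕ), 1 ≤ k → k < S' → cE ≤ (triSitePercolation p).real (compl ⁻¹' triRingAt z k))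
    (hIr : ∀ (z : Site 2) (k : ℕ), 1 ≤ k → k < S' → cI ≤ (triSitePercolation p).real (compl ⁻¹' triInnerRingAt z k))
    {k₀ K : ℕ} (hk₀ : 1 ≤ k₀) (hKS : ∀ j < K, 8 * trapScale k₀ j < S) (hKS' : ∀ j < K, trapScale k₀ j < S') (T : ℕ) :
    (triSitePercolation p).real {ω | ∃ u < T, ∃ c z, Q.lowestSeq ω u = some (c, z) ∧ TrapNoRSWL (Q.lower c z) z k₀ K ω} ≤
      T * (1 - cF ^ 2 * cE * cI) ^ K := by
  classical
  have h0 : 0 ≤ (1 - cF ^ 2 * cE * cI) ^ K := by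
    refine pow_nonneg ?_ K
    have h1 : cF ^ 2 ≤ 1 := pow_le_one₀ hcF.le hcF1
    have h2 : cF ^ 2 * cE * cI ≤ 1 := by
      calc cF ^ 2 * cE * cI ≤ 1 * 1 * 1 := by gcongr
        _ = 1 := by ring
    linarith
  have key := JDomain.real_exists_lowestSeq_not_mem_le hcut hdual p
    (Prot := fun c z => {ω | TrapNoRSWL (Q.lower c z) z k₀ K ω}ᶜ)
    (G := fun c z => trapScalesFinset₂ z k₀ K \ Q.lower c z) h0
    (fun c z _ => (determinedBy_trapNoRSWL (Q.lower c z) z k₀ K).compl) (fun c z _ => Finset.disjoint_sdiff)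
    (fun c z _ => by
      rw [compl_compl]
      have h1 := (real_iInter_compl_trapRSW₃_le_at p hcF hcE hcI hF hEr hIr z hk₀ K hKS hKS').1
      unfold triSitePercolation at h1
      exact (measureReal_mono (trapNoRSWL_subset (Q.lower c z) z k₀ K) (measure_ne_top _ _)).trans h1) T
  unfold triSitePercolation
  refine le_trans (measureReal_mono ?_ (measure_ne_top _ _)) key
  rintro ω ⟨u, hu, c, z, h, hfail⟩
  exact ⟨u, hu, c, z, h, fun hno => hno hfail⟩

/-- **Probability of a raw-bad term of the inner exploration from below**:
`P_p(∃ u < T, IntSeqFailRaw m u k₀ K) ≤ T (1 - c_F² c_E c_I)^K` (`m ≥ 5`). [cite: Nolin2008, §4.4 Lemma 15 (proof, (4.20)), internal extremities (arXiv 0711.4948: Lemma 14)] [cite: Kesten1987, Lemma 2 (2.26)] -/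
theorem real_exists_intSeqFailRaw_le_at (p : unitInterval) {cF cE cI : ℝ} (hcF : 0 < cF) (hcF1 : cF ≤ 1) (hcE : 0 ≤ cE) (hcE1 : cE ≤ 1)
    (hcI : 0 ≤ cI) (hcI1 : cI ≤ 1) {S S' : ℕ}
    (hF : ∀ (z : Site 2) (k : ℕ), 1 ≤ k → k < S → cF ≤ (triSitePercolation p).real (triFrameAt z k))
    (hEr : ∀ (z : Site 2) (k : ℕ), 1 ≤ k → k < S' → cE ≤ (triSitePercolation p).real (compl ⁻¹' triRingAt z k))
    (hIr : ∀ (z : Site 2) (k : ℕ), 1 ≤ k → k < S' → cI ≤ (triSitePercolation p).real (compl ⁻¹' triInnerRingAt z k))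
    {m k₀ K : ℕ} (hm : 5 ≤ m) (hk₀ : 1 ≤ k₀) (hKS : ∀ j < K, 8 * trapScale k₀ j < S) (hKS' : ∀ j < K, trapScale k₀ j < S') (T : ℕ) :
    (triSitePercolation p).real {ω | ∃ u < T, IntSeqFailRaw m u k₀ K ω} ≤ T * (1 - cF ^ 2 * cE * cI) ^ K := by
  refine le_trans (measureReal_mono ?_ (measure_ne_top _ _))
    ((intDom m).real_exists_lowestSeq_noRSWL_le_at (intDom_cutProp hm) (intDom_dualProp hm) p hcF hcF1 hcE hcE1 hcI hcI1 hF hEr hIr hk₀ hKS hKS' T)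
  rintro ω ⟨u, hu, c, z, h, hfail⟩
  exact ⟨u, hu, c, z, h, (intNoRSW₃_iff_trapNoRSWL).1 (intNoRSW₃_of_failRaw hfail)⟩

/-- **Probability of a raw-bad term of the inner exploration from above**:
`P_p(∃ u < T, IntSeqFailRawUp m u k₀ K) ≤ T (1 - c_F² c_E c_I)^K` (`m ≥ 5`). [cite: Nolin2008, §4.4 Lemma 15 (proof, (4.20)), internal extremities (arXiv 0711.4948: Lemma 14)] [cite: Kesten1987, Lemma 2 (2.26)] -/
theorem real_exists_intSeqFailRawUp_le_at (p : unitInterval) {cF cE cI : ℝ} (hcF : 0 < cF) (hcF1 : cF ≤ 1) (hcE : 0 ≤ cE) (hcE1 : cE ≤ 1)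
    (hcI : 0 ≤ cI) (hcI1 : cI ≤ 1) {S S' : ℕ}
    (hF : ∀ (z : Site 2) (k : ℕ), 1 ≤ k → k < S → cF ≤ (triSitePercolation p).real (triFrameAt z k))
    (hEr : ∀ (z : Site 2) (k : ℕ), 1 ≤ k → k < S' → cE ≤ (triSitePercolation p).real (compl ⁻¹' triRingAt z k))
    (hIr : ∀ (z : Site 2) (k : ℕ), 1 ≤ k → k < S' → cI ≤ (triSitePercolation p).real (compl ⁻¹' triInnerRingAt z k))
    {m k₀ K : ℕ} (hm : 5 ≤ m) (hk₀ : 1 ≤ k₀) (hKS : ∀ j < K, 8 * trapScale k₀ j < S) (hKS' : ∀ j < K, trapScale k₀ j < S') (T : ℕ) :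
    (triSitePercolation p).real {ω | ∃ u < T, IntSeqFailRawUp m u k₀ K ω} ≤ T * (1 - cF ^ 2 * cE * cI) ^ K := by
  refine le_trans (measureReal_mono ?_ (measure_ne_top _ _))
    ((intDom m).flip.real_exists_lowestSeq_noRSWL_le_at (JDomain.flip_cutProp (intDom_cutProp hm))
      (JDomain.flip_dualProp (intDom_dualProp hm)) p hcF hcF1 hcE hcE1 hcI hcI1 hF hEr hIr hk₀ hKS hKS' T)
  rintro ω ⟨u, hu, d, z, h, hfail⟩
  exact ⟨u, hu, d, z, h, intNoRSWL_of_failRawUp hfail⟩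

end Literature.Probability.Percolation
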